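import Summits.BirchSwinnertonDyer.Rank1Residual.GaloisImage.CanonicalComparisonLevelChange
import HarnessLib

/-!
# The canonical finite–singular comparison map DEPENDS ON THE PRIMITIVE ROOT: the maps for `η` and
# for `η⁻¹` are NEGATIVES of each other on `H¹_ur` (cell `b2b-bsdres`, team n1011, seat p11 GEN 11;
# row T-PORT-NEG, file N1 — the local lemma behind the ANOMALY report on the universal-closure PORT
# `KatoKuriharaPortThreeAt`, `HOME/b2b-bsdres-n1011-p11/gen11/PORT-ANOMALY.md`)

HONEST FRAMING (cell `b2b-bsdres`, run/shared/lean/b2b/bsd-rank1-residual/, verbatim in every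
file): the goal of the cell is to DELETE the COMBINATION-SHAPED residual classes of the
Birch–Swinnerton-Dyer formula for ALL analytic-rank `≤ 1` elliptic curves over `ℚ` — "full BSD
formula for every rank `≤ 1` curve in class `C`" assembled STRICTLY from published theorems — so
that the rank-`≤ 1` remainder becomes exactly the CONSTRUCTION-SHAPED classes, which are TYPED
(missing-input `Prop`s), NOT attempted. This is not "finishing BSD". Team n1011: research route on
the CONSTRUCTION-SHAPED class X4 / §I N11.  TOOL theorems of local Galois cohomology; no definition,
no named fact, no `sorry`; nothing is booked; no mark / label / count moves.

## What, and why

Kim's generator-fixed convention (AJM 148 §2.1.2 / §2.2.2: "the choice of generators of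
`Gal(ℚ(μ_ℓ)/ℚ)` … corresponds to the choice of the primitive roots") enters the tree's
`KolyvaginDatum.HasCanonicalComparison N η` through the inertia element `τ` over `η_𝔮`:
`w(τ) = Q(φ⁻¹) z(φ)` (`IsFiniteSingularComparisonWith`, Rubin PCMI Def. 1.9.6).  Replacing `η` by
`η⁻¹` replaces `τ` by `τ⁻¹`, and a crossed homomorphism of an UNRAMIFIED module satisfies
`w(τ⁻¹) = −w(τ)`; so **the canonical map for `η⁻¹` is the NEGATIVE of the canonical map for `η` on
`H¹_ur`** (`fs_add_fs_eq_zero_of_isFiniteSingularComparisonWith_inv`, local;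
`fs_eq_neg_fs_of_hasCanonicalComparison_inv`, over `ℚ`), and a class of `H¹_ur` on which the two
maps AGREE is `2`-torsion under `φ^{fs}`, hence ZERO when `φ^{fs}` is injective on `H¹_ur` and the
coefficients are killed by an odd `N` (`eq_zero_of_fs_eq_fs_of_hasCanonicalComparison_inv`).  This
is the local half of the observation that the two-level dictionary `KatoKuriharaDictionaryThreeAt₂`
— whose clause (COMP) compares Kato's families for two Kolyvagin data — cannot hold for canonical
data with different primitive roots, so that its universal closure `KatoKuriharaPortThreeAt` (which
quantifies over all guarded pairs, `∃ η` separately) is not dischargeable (file N2).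
References: K. Rubin, PCMI 18 (2011), Def. 1.9.4, Def. 1.9.6, Prop. 1.9.5 [Rubin2011]; C.-H. Kim,
AJM 148 (2026) = arXiv:2203.12159, §2.1.2, §2.2.2 [Kim2022StructureSelmer]; B. Mazur, K. Rubin,
Mem. AMS 799 (2004), Def. 1.2.2 [MazurRubin2004]; J.-P. Serre, *Local Fields*, IV §4 Prop. 17.
-/

noncomputable section

open Field Module NumberField IsDedekindDomain
open Literature.NumberTheory.GaloisRepresentations
open Literature.NumberTheory.GaloisRepresentations.DiscreteGaloisModule
open Literature.NumberTheory.GaloisCohomology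
open scoped ContRepresentation NumberField

universe u

namespace Summit.BirchSwinnertonDyer.Rank1Residual.GaloisImage.PortNeg

/-! ### §1 Local: two comparison maps computed with `τ` and with `τ⁻¹` are negatives -/

section Local

variable {F : Type u} [Field F] [ValuativeRel F] [TopologicalSpace F] [IsNonarchimedeanLocalField F]
variable {M : Type u} [AddCommGroup M] [TopologicalSpace M] [DiscreteTopology M]
variable (ρ : DiscreteGaloisModule F M) (N : ℕ) [Module (ZMod N) M] [Module.Free (ZMod N) M]
  [Module.Finite (ZMod N) M]

/-- **Comparison maps over inverse generators are negatives of each other on `H¹_ur`.**  Let the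
inertia group act trivially on `M`, `χ : Γ_F → G` a homomorphism, `η` a generator of `G` hit by some
inertia element (the mod `ℓ` cyclotomic character and a primitive root).  If `fs` is the
finite–singular comparison map computed with `(φ, τ)` for EVERY inertia `τ` over `η`, and `fs′` the
one computed with `(φ, τ′)` for every inertia `τ′` over `η⁻¹`, then `fs x + fs′ x = 0` for every
unramified `x`: for `τ` over `η`, `w(τ) = Q(φ⁻¹) z(φ) = w′(τ⁻¹) = −w′(τ)`, so a representative of
`fs x + fs′ x` vanishes on the `η`-fibre of inertia, hence on inertia
(`KSDevissage.forall_absInertia_apply_eq_zero_of_fibre`), i.e. is unramified.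
[cite: Rubin2011, Def. 1.9.6 and Prop. 1.9.5 (p. 14)] [cite: Kim2022StructureSelmer, §2.1.2 and §2.2.2] -/
theorem fs_add_fs_eq_zero_of_isFiniteSingularComparisonWith_inv
    (hI : ∀ τ ∈ absInertia F, ρ τ = 1)
    {G : Type*} [Group G] (χ : absoluteGaloisGroup F →* G) {η : G}
    (hgen : Subgroup.zpowers η = ⊤) (hτ₀ : ∃ τ₀ ∈ absInertia F, χ τ₀ = η)
    (φ : absoluteGaloisGroup F) {fs fs' : galoisCohomology ρ 1 →+ ρ.SingularQuotient}
    (hfs : ∀ τ ∈ absInertia F, χ τ = η → ρ.IsFiniteSingularComparisonWith N fs φ τ)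
    (hfs' : ∀ τ ∈ absInertia F, χ τ = η⁻¹ → ρ.IsFiniteSingularComparisonWith N fs' φ τ)
    {x : galoisCohomology ρ 1} (hx : x ∈ unramifiedSubgroup ρ 1) :
    fs x + fs' x = 0 := by
  have hI' : ∀ τ ∈ absInertia F, ∀ m : M, ρ τ m = m := fun τ hτ m => by
    rw [hI τ hτ, Module.End.one_apply]
  obtain ⟨z, rfl⟩ := oneCocycleClass_surjective ρ.toTopRep x
  -- representatives `w`, `w′` of `fs [z]`, `fs′ [z]`
  obtain ⟨c, hc⟩ := QuotientAddGroup.mk_surjective (fs (oneCocycleClass ρ.toTopRep z))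
  obtain ⟨w, rfl⟩ := oneCocycleClass_surjective ρ.toTopRep c
  obtain ⟨c', hc'⟩ := QuotientAddGroup.mk_surjective (fs' (oneCocycleClass ρ.toTopRep z))
  obtain ⟨w', rfl⟩ := oneCocycleClass_surjective ρ.toTopRep c'
  have hw : ρ.singularMap (oneCocycleClass ρ.toTopRep w) = fs (oneCocycleClass ρ.toTopRep z) := hc
  have hw' : ρ.singularMap (oneCocycleClass ρ.toTopRep w') = fs' (oneCocycleClass ρ.toTopRep z) :=
    hc'
  -- `w + w′` vanishes on the `η`-fibre of inertia, hence on inertia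
  have hvan : ∀ τ ∈ absInertia F, (w + w').1 τ = 0 := by
    refine KSDevissage.forall_absInertia_apply_eq_zero_of_fibre ρ hI χ hgen hτ₀ (w + w')
      fun τ hτ hχτ => ?_
    have hτ' : τ⁻¹ ∈ absInertia F := inv_mem hτ
    have h1 : w.1 τ = ρ.comparisonOp N φ (z.1 φ) := (hfs τ hτ hχτ).apply_eq z w hx hw
    have h2 : w'.1 τ⁻¹ = ρ.comparisonOp N φ (z.1 φ) :=
      (hfs' τ⁻¹ hτ' (by rw [map_inv, hχτ])).apply_eq z w' hx hw'
    -- the crossed-homomorphism identity at `τ⁻¹ · τ`: `0 = w′(τ⁻¹) + w′(τ)`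
    have hcoc : w'.1 (τ⁻¹ * τ) = w'.1 τ⁻¹ + ρ.toTopRep.ρ τ⁻¹ (w'.1 τ) := w'.2 τ⁻¹ τ
    rw [inv_mul_cancel, contOneCocycles.apply_one] at hcoc
    have hρ : ρ.toTopRep.ρ τ⁻¹ (w'.1 τ) = w'.1 τ := hI' τ⁻¹ hτ' _
    rw [hρ] at hcoc
    have h3 : w'.1 τ = -w'.1 τ⁻¹ := by
      have h4 : w'.1 τ⁻¹ + w'.1 τ = 0 := hcoc.symm
      exact eq_neg_of_add_eq_zero_right h4
    rw [Submodule.coe_add, ContinuousMap.add_apply, h1, h3, h2, add_neg_cancel]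
  have hur : oneCocycleClass ρ.toTopRep (w + w') ∈ unramifiedSubgroup ρ 1 :=
    (X11b.LocBridge.mem_unramifiedSubgroup_one_iff_forall_eq_zero ρ hI' _).mpr hvan
  rw [← hw, ← hw', ← FSComp.singularMap_oneCocycleClass_add]
  exact (singularMap_eq_zero_iff ρ _).mpr hur

omit [ValuativeRel F] [TopologicalSpace F] [IsNonarchimedeanLocalField F] [Module.Free (ZMod N) M]
  [Module.Finite (ZMod N) M] in
/-- In `H¹(F, M)` with `M` a `ℤ/N`-module for an ODD `N`, a `2`-torsion class vanishes
(`H¹(F, M)` is killed by `N`: tree `galoisCohomology.nsmul_eq_zero_of_forall`). [folklore] -/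
theorem eq_zero_of_two_nsmul_eq_zero (hN : Odd N) (x : galoisCohomology ρ 1) (hx : 2 • x = 0) :
    x = 0 := by
  have hM : ∀ m : M, N • m = 0 := fun m => by
    rw [← Nat.cast_smul_eq_nsmul (ZMod N), ZMod.natCast_self, zero_smul]
  have h := galoisCohomology.nsmul_eq_zero_of_forall ρ hM x
  obtain ⟨m, rfl⟩ := hN
  rw [add_nsmul, one_nsmul, mul_nsmul, hx, nsmul_zero, zero_add] at h
  exact h

end Local

/-! ### §2 Over `ℚ`: canonical data over `η` and over `η⁻¹` -/

section Rat

variable {M : Type} [AddCommGroup M] [TopologicalSpace M] [DiscreteTopology M]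
  {ρ : DiscreteGaloisModule ℚ M} {N : ℕ}
  [Module (ZMod N) M] [Module.Free (ZMod N) M] [Module.Finite (ZMod N) M]

/-- **The canonical comparison maps of two Kolyvagin data over INVERSE primitive roots are
negatives of each other on `H¹_ur(ℚ_𝔮, M)`**: if `D` has THE canonical maps for `η` and `D′` THE
canonical maps for `η⁻¹` (both `HasCanonicalComparison N`), then at every common prime `𝔮` where `M`
is unramified, `D′.fs_𝔮 x = − D.fs_𝔮 x` for `x ∈ H¹_ur`.  Kim's convention is generator-FIXED for
exactly this reason. [cite: Kim2022StructureSelmer, §2.1.2 and §2.2.2]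
[cite: Rubin2011, Def. 1.9.4 and Def. 1.9.6 (p. 14)] -/
theorem fs_eq_neg_fs_of_hasCanonicalComparison_inv {D D' : KolyvaginDatum ρ}
    {η : (q : HeightOneSpectrum (𝓞 ℚ)) → (ZMod (Ideal.absNorm q.asIdeal))ˣ}
    (hD : D.HasCanonicalComparison N η) (hD' : D'.HasCanonicalComparison N fun q => (η q)⁻¹)
    {q : HeightOneSpectrum (𝓞 ℚ)} (hq : q ∈ D.primes) (hq' : q ∈ D'.primes)
    (hur : GaloisRep.IsUnramifiedAt q ρ)
    {x : galoisCohomology (GaloisRep.toLocal q ρ) 1}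
    (hx : x ∈ unramifiedSubgroup (GaloisRep.toLocal q ρ) 1) :
    D'.fs q x = -D.fs q x := by
  have hI : ∀ t ∈ absInertia (q.adicCompletion ℚ), GaloisRep.toLocal q ρ t = 1 := fun t ht =>
    (GaloisRep.isUnramifiedAt_iff_toLocal_holds q ρ).1 hur t ht
  obtain ⟨φ, hφ⟩ := exists_isAbsArithFrob_holds (F := q.adicCompletion ℚ)
  have hsum := fs_add_fs_eq_zero_of_isFiniteSingularComparisonWith_inv (GaloisRep.toLocal q ρ) N hI
    (localNormCyclotomicCharacter q) (hD.zpowers_eq_top hq)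
    (KSDevissage.exists_absInertia_localNormCyclotomicCharacter_eq q (η q)) φ
    (fun t ht hχt => hD.at hq hφ ht hχt) (fun t ht hχt => hD'.at hq' hφ ht hχt) hx
  exact eq_neg_of_add_eq_zero_right hsum

/-- **A class of `H¹_ur(ℚ_𝔮, M)` on which the canonical maps for `η` and for `η⁻¹` AGREE is ZERO**
(`N` odd, `φ^{fs}_𝔮` injective on `H¹_ur` — the admissibility of the canonical datum,
`FSComp.isAdmissible_of_hasCanonicalComparison_frobeniusClassPrimes[_primePow]`): `fs x = −fs x`
gives `fs (x + x) = 0`, so `2 • x = 0`, so `x = 0`. [cite: Kim2022StructureSelmer, §2.1.2 and §2.2.2]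
[cite: MazurRubin2004, Lemma 1.2.3 (p. 10–11)] -/
theorem eq_zero_of_fs_eq_fs_of_hasCanonicalComparison_inv (hN : Odd N) {D D' : KolyvaginDatum ρ}
    {η : (q : HeightOneSpectrum (𝓞 ℚ)) → (ZMod (Ideal.absNorm q.asIdeal))ˣ}
    (hD : D.HasCanonicalComparison N η) (hD' : D'.HasCanonicalComparison N fun q => (η q)⁻¹)
    {q : HeightOneSpectrum (𝓞 ℚ)} (hq : q ∈ D.primes) (hq' : q ∈ D'.primes)
    (hur : GaloisRep.IsUnramifiedAt q ρ)
    (hinj : Function.Injective fun y : unramifiedSubgroup (GaloisRep.toLocal q ρ) 1 =>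
      D.fs q (y : galoisCohomology (GaloisRep.toLocal q ρ) 1))
    {x : galoisCohomology (GaloisRep.toLocal q ρ) 1}
    (hx : x ∈ unramifiedSubgroup (GaloisRep.toLocal q ρ) 1) (h : D.fs q x = D'.fs q x) : x = 0 := by
  have hneg := fs_eq_neg_fs_of_hasCanonicalComparison_inv hD hD' hq hq' hur hx
  -- `fs (x + x) = 0 = fs 0` on `H¹_ur`, so `x + x = 0`
  have h2 : (⟨x, hx⟩ + ⟨x, hx⟩ : unramifiedSubgroup (GaloisRep.toLocal q ρ) 1) = 0 := by
    apply hinj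
    change D.fs q (x + x) = D.fs q ((0 : unramifiedSubgroup (GaloisRep.toLocal q ρ) 1) : _)
    rw [map_add, AddSubgroup.coe_zero, map_zero]
    nth_rw 2 [h]
    rw [hneg, add_neg_cancel]
  have h2' : 2 • x = 0 := by
    have h3 := congrArg (fun y : unramifiedSubgroup (GaloisRep.toLocal q ρ) 1 =>
      (y : galoisCohomology (GaloisRep.toLocal q ρ) 1)) h2
    simp only [AddSubgroup.coe_add, AddSubgroup.coe_zero] at h3
    rw [two_nsmul]
    exact h3
  exact eq_zero_of_two_nsmul_eq_zero (GaloisRep.toLocal q ρ) N hN x h2'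

end Rat

end Summit.BirchSwinnertonDyer.Rank1Residual.GaloisImage.PortNeg

end
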